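import Summits.PneNP.PneNP.Theorems.BruckRyserSosSosBlindPlanesRelabel

/-!
# PneNP / BruckRyserSos — counting permutations that move a set into a set

Route `PneNP/BruckRyserSos`, crux stmt-PneNP-16761 (`SosBlindPlanes`); companion of file
`…Relabel`. The number of permutations `σ` of a finite type `γ` mapping a finite set `A` into a
finite set `I` is `C(|I|,|A|) · |A|! · (|γ| - |A|)!` (`card_perm_image_subset`): fibre over the
image set `σ(A) ∈ I.powersetCard |A|`, each fibre being a coset of the setwise stabiliser of `A`,
whose size `|A|! (|γ| - |A|)!` is Mathlib's `DomMulAct.stabilizer_card` for the indicator of `A`.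
This is the count behind the template-sum formula for traces of invariant moment matrices
(file `…TemplateSum`).

References: folklore (orbit–stabiliser); P. J. Cameron, *Permutation Groups* (1999), §1.
-/

set_option linter.dupNamespace false -- `Summit.PneNP.PneNP.…`: summit = sub-problem name (D-0017 single-conjunct layout)

namespace Summit.PneNP.PneNP.Theorems.SosBlindPlanes

open Finset Function

/-! ### Counting permutations that move a set into a set -/

/-- The number of permutations of `γ` preserving a finite set `A` is `|A|! · (|γ| - |A|)!`.
[folklore] -/
theorem card_perm_image_eq_self {γ : Type*} [Fintype γ] [DecidableEq γ] (A : Finset γ) :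
    (univ.filter fun σ : Equiv.Perm γ => A.image σ = A).card =
      A.card.factorial * (Fintype.card γ - A.card).factorial := by
  classical
  -- permutations preserving `A` are those preserving the indicator function of `A`
  let f : γ → Bool := fun x => decide (x ∈ A)
  have key : ∀ σ : Equiv.Perm γ, A.image σ = A ↔ f ∘ σ = f := by
    intro σ
    constructor
    · intro h
      funext x
      simp only [comp_apply, f]
      by_cases hx : x ∈ A
      · have : σ x ∈ A := by rw [← h]; exact mem_image_of_mem _ hx
        simp [hx, this]
      · have : σ x ∉ A := by
          intro hσx
          rw [← h] at hσx
          obtain ⟨y, hy, hxy⟩ := mem_image.1 hσx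
          exact hx (σ.injective hxy ▸ hy)
        simp [hx, this]
    · intro h
      apply eq_of_subset_of_card_le
      · intro y hy
        obtain ⟨x, hx, rfl⟩ := mem_image.1 hy
        have := congrFun h x
        simp only [comp_apply, f] at this
        simpa [hx] using this
      · rw [card_image_of_injective _ σ.injective]
  have h1 : (univ.filter fun σ : Equiv.Perm γ => A.image σ = A).card =
      Fintype.card {σ : Equiv.Perm γ // f ∘ σ = f} := by
    rw [Fintype.card_subtype]
    congr 1
    exact filter_congr fun σ _ => key σ
  rw [h1, DomMulAct.stabilizer_card f, Fintype.prod_bool]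
  have ht : Fintype.card {x // f x = true} = A.card := by
    rw [Fintype.card_subtype]
    congr 1; ext x; simp [f]
  have hff : Fintype.card {x // f x = false} = Fintype.card γ - A.card := by
    rw [Fintype.card_subtype]
    have : (univ.filter fun x => f x = false) = univ \ A := by
      ext x; simp [f]
    rw [this, card_sdiff_of_subset (subset_univ _), card_univ]
  rw [ht, hff]

/-- For two finite sets of the same size, the permutations carrying one onto the other are as
numerous as those preserving the first. [folklore] -/
theorem card_perm_image_eq {γ : Type*} [Fintype γ] [DecidableEq γ] (A A' : Finset γ)
    (h : A.card = A'.card) :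
    (univ.filter fun σ : Equiv.Perm γ => A.image σ = A').card =
      A.card.factorial * (Fintype.card γ - A.card).factorial := by
  classical
  -- a permutation `σ₀` carrying `A` onto `A'`
  obtain ⟨σ₀, hσ₀⟩ : ∃ σ₀ : Equiv.Perm γ, A.image σ₀ = A' := by
    let e : A ≃ A' := (A.equivFin.trans (finCongr h)).trans A'.equivFin.symm
    let f' : γ → γ := fun x => if hx : x ∈ A then (e ⟨x, hx⟩ : γ) else x
    have hf' : Set.InjOn f' A := by
      intro x hx y hy hxy
      simp only [mem_coe] at hx hy
      simp only [f', hx, hy, dite_true] at hxy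
      exact congrArg Subtype.val (e.injective (Subtype.val_injective hxy))
    obtain ⟨σ, hσ⟩ := exists_perm_forall_apply_eq A (f := id) (Set.injOn_id _) hf'
    refine ⟨σ, ?_⟩
    apply eq_of_subset_of_card_le
    · intro y hy
      obtain ⟨x, hx, rfl⟩ := mem_image.1 hy
      rw [show σ x = f' x from hσ x hx]
      simp only [f', hx, dite_true]
      exact coe_mem _
    · rw [card_image_of_injective _ σ.injective, h]
  rw [← card_perm_image_eq_self A]
  -- `ρ ↦ σ₀ ∘ ρ` is a bijection from the stabiliser of `A` onto the transporter
  symm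
  refine card_bij (fun ρ _ => σ₀ * ρ) (fun ρ hρ => ?_) (fun ρ _ ρ' _ h => mul_left_cancel h)
    (fun σ hσ => ⟨σ₀⁻¹ * σ, ?_, by group⟩)
  · simp only [mem_filter, mem_univ, true_and] at hρ ⊢
    rw [Equiv.Perm.coe_mul, ← image_image, hρ, hσ₀]
  · simp only [mem_filter, mem_univ, true_and] at hσ ⊢
    rw [Equiv.Perm.coe_mul, ← image_image, hσ, ← hσ₀, image_image]
    have : (⇑σ₀⁻¹ ∘ ⇑σ₀) = id := by
      funext x; simp
    rw [this, image_id]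

/-- **The number of permutations of a finite type `γ` mapping `A` into `I` is
`C(|I|,|A|) · |A|! · (|γ| - |A|)!`.** [folklore] -/
theorem card_perm_image_subset {γ : Type*} [Fintype γ] [DecidableEq γ] (A I : Finset γ) :
    (univ.filter fun σ : Equiv.Perm γ => A.image σ ⊆ I).card =
      I.card.choose A.card * (A.card.factorial * (Fintype.card γ - A.card).factorial) := by
  classical
  -- fibre over the image set `A.image σ ∈ I.powersetCard |A|`
  have hmaps : Set.MapsTo (fun σ : Equiv.Perm γ => A.image σ)
      (univ.filter (fun σ : Equiv.Perm γ => A.image σ ⊆ I) : Finset (Equiv.Perm γ))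
      (I.powersetCard A.card : Finset (Finset γ)) := by
    intro σ hσ
    simp only [coe_filter, mem_univ, true_and, Set.mem_setOf_eq] at hσ
    exact mem_coe.2 (mem_powersetCard.2 ⟨hσ, card_image_of_injective _ σ.injective⟩)
  rw [card_eq_sum_card_fiberwise hmaps]
  have : ∀ A' ∈ I.powersetCard A.card,
      ((univ.filter fun σ : Equiv.Perm γ => A.image σ ⊆ I).filter
        fun σ : Equiv.Perm γ => A.image σ = A').card =
        A.card.factorial * (Fintype.card γ - A.card).factorial := by
    intro A' hA'
    obtain ⟨hA'I, hcard⟩ := mem_powersetCard.1 hA'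
    rw [filter_filter, ← card_perm_image_eq A A' hcard.symm]
    congr 1
    apply filter_congr
    intro σ _
    constructor
    · exact fun h => h.2
    · intro h; exact ⟨h ▸ hA'I, h⟩
  rw [sum_congr rfl this, sum_const, card_powersetCard, smul_eq_mul]

end Summit.PneNP.PneNP.Theorems.SosBlindPlanes
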